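import Summits.QuantumFields.BalabanUV.T4Continuum.Support.NE3SlicePoincareSkeleton
import Summits.QuantumFields.BalabanUV.T4Continuum.Support.NE3CurlOfGaugeDir
import HarnessLib

/-!
# NE3SlicePoincareGradientBudget (T⁴ programme, node NE3, row K6 of the owner's ruling ρ-g22-2, part K6b-S5 of the cut ρ-g23-3 §3) — (S5): THE
# COVARIANT-GRADIENT ENERGY OF `η′ = Y − gaugeDir W ζ′` AGAINST THE CURL OF `Y`, THE DIVERGENCE `ρ`, `‖ζ′‖²` AND `‖η′‖²` IN nhs CURRENCY

NE3 (node U1b) formalisation swarm `b2b-balaban-t4-ne3-formalise-*`, leaf seat `b2b-balaban-t4-ne3-formalise-leaf-02` (gen 6), row **K6**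
(assembly of the curved (P♮), booked → leaf-02 lineage; blueprint `HOME/t4/b2b-balaban-t4-ne3-p1/g23/D-ne3p1-g23-1.md` = ruling ρ-g23-3 §1 (S5):
«`g² ≤ curlSq_nhs(η′) + ρ² + 2d·a·Σ‖η′‖²_op`; `curlSq(η′) ≤ 2·curlSq(Y) + 8d²a²·ζ²`»).  Over leaf-03's w4-W `NE3CovariantWeitzenbock.sum_nhsNormSq_covFd_le`,
the owner's K6-cg `NE3CurlOfGaugeDir.nhsNormSq_curlAt_gaugeDir_le` ∕ `curlAt_sub` and K6a `NE3SlicePoincareSkeleton.dirSq_le_card_mul` BY NAME.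
All [folklore], 0 sorry, 0 def:
§1 `card_plane_le` (`#(Plane d) ≤ d²`), **`sum_nhsNormSq_curl_gaugeDir_le`** (`Σ_{z∈F}Σ_π nhsNormSq (curl W (gaugeDir W ζ) (z,π)) ≤ 4d²a²·Σ_{z∈F} nhsNormSq (ζ z)`;
   planes have `μ < ν`, so the owner's pointwise bound applies), **`sum_nhsNormSq_curl_sub_gaugeDir_le`** (`… (Y − gaugeDir W ζ) … ≤ 2·Σ nhs curl Y + 8d²a²·Σ nhsNormSq ζ`);
§2 **`covFd_energy_le` — THE (S5) BUDGET LINE**: for `P ≥ 1`, unitary `P`-periodic `W` with `SmallField W a` (`0 ≤ a`), `P`-periodic `Y`, `ζ`, and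
   `η′ := Y − gaugeDir W ζ` (pointwise):
   `Σ_xΣ_μΣ_ν nhsNormSq (covFd W η′ x μ ν) ≤ 4·Σ_{z}Σ_π nhsNormSq (curl W Y (z,π)) + 16d²a²·Σ nhsNormSq ζ + Σ nhsNormSq (covDiv W η′) + (2da + 32da²)·card n·Σ_xΣ_κ nhsNormSq (η′ x κ)`
   — every quantity in the nhs currency of K1-inst ∕ K4-d1 ∕ K6a (`ρ² = Σ nhsNormSq (covDiv W η′)` verbatim).
HONEST FRAMING.  Bookkeeping on OUR lattice objects at ONE unitary background in the small-field class; nothing about Bałaban's minimisers;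
(P♮)_W, (ML_w) at `W ≠ 1`, T-E_w and NE3 are NOT proved; spine PROVED 0∕9; finite T⁴ rung (B)+1 — NOT infinite volume, NOT mass gap, NOT
BetaPertH, NOT Clay.  ABSOLUTE RULE kept: no printed sentence is a hypothesis (context only: [Balaban1985BackgroundPropagators] §A (3.3), (3.8);
[Balaban1985Variational] (83) p. 290).  PLACEMENT: `Summits/QuantumFields/BalabanUV/`; imports accepted modules only; moves nothing.
HONEST DEPENDENCY: continuum YM on T⁴ ⇐ BetaPertH ∧ nine spine estimates (0/9 proved); BetaPertH ⇐ (D1) ∧ (D4) ∧ CAP+tail; G-an2-4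
gates asym, D1 and NE2/3/4.
-/

set_option autoImplicit false

open scoped BigOperators Matrix.Norms.L2Operator
open Finset

namespace Summit.QuantumFields.BalabanUV.T4Continuum.NE3SlicePoincareGradientBudget

open Literature.MathematicalPhysics.QuantumFieldTheory.Balaban1983to89
open B7Prop1Explicit MatrixNorms
open T4AveragingDeficitWall (IsUnitaryCfg SmallField curl curlAt dirSq)
open T4AveragingDeficitWallBoundary (IsPeriodicCfg periodBox)
open AveragingDeficitPeriodicCounting (IsPeriodicDir)
open AveragingDeficitCovGrad (covFd)
open BlockAveragePushDirGauge (gaugeDir isPeriodicDir_gaugeDir)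
open NE3CovariantCalculus (nhsNormSq_sub_le)
open NE3CovariantWeitzenbock (covDiv sum_nhsNormSq_covFd_le)
open NE3HessShapes (plaqsOf sum_plaqsOf)
open NE3CurlOfGaugeDir (nhsNormSq_curlAt_gaugeDir_le curlAt_sub)
open NE3SlicePoincareSkeleton (dirSq_le_card_mul)

noncomputable section

variable {d : ℕ} {n : Type*} [Fintype n] [DecidableEq n]

/-! ## §1 The curl energy of a gauge direction in nhs currency -/

omit [Fintype n] [DecidableEq n] in
/-- There are at most `d²` coordinate planes. [folklore] -/
theorem card_plane_le (d : ℕ) : (Fintype.card (T4AveragingDeficitWall.Plane d) : ℝ) ≤ (d : ℝ) ^ 2 := by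
  have h : Fintype.card (T4AveragingDeficitWall.Plane d) ≤ Fintype.card (Fin d × Fin d) := Fintype.card_subtype_le _
  rw [Fintype.card_prod, Fintype.card_fin] at h
  have h' : (Fintype.card (T4AveragingDeficitWall.Plane d) : ℝ) ≤ ((d * d : ℕ) : ℝ) := by exact_mod_cast h
  simpa [sq] using h'

/-- **`Σ_{z∈F} Σ_π nhsNormSq (curl W (gaugeDir W ζ) (z,π)) ≤ 4·d²·a²·Σ_{z∈F} nhsNormSq (ζ z)`** (unitary `W`, `SmallField W a`; the owner's pointwise
`nhsNormSq_curlAt_gaugeDir_le` on every plane `μ < ν`, `#(Plane d) ≤ d²`). [folklore] -/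
theorem sum_nhsNormSq_curl_gaugeDir_le [Nonempty n] {W : Site d → Fin d → (Matrix n n ℂ)ˣ} (hW : IsUnitaryCfg W) {a : ℝ}
    (hWa : SmallField W a) (ζ : Site d → Matrix n n ℂ) (F : Finset (Site d)) :
    ∑ z ∈ F, ∑ π : T4AveragingDeficitWall.Plane d, nhsNormSq (curl W (gaugeDir W ζ) (z, π))
      ≤ 4 * (d : ℝ) ^ 2 * a ^ 2 * ∑ z ∈ F, nhsNormSq (ζ z) := by
  have ha2 : 0 ≤ a ^ 2 := sq_nonneg _
  have hpt : ∀ z ∈ F, ∑ π : T4AveragingDeficitWall.Plane d, nhsNormSq (curl W (gaugeDir W ζ) (z, π))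
      ≤ (d : ℝ) ^ 2 * (4 * a ^ 2 * nhsNormSq (ζ z)) := by
    intro z _
    calc ∑ π : T4AveragingDeficitWall.Plane d, nhsNormSq (curl W (gaugeDir W ζ) (z, π))
        ≤ ∑ _π : T4AveragingDeficitWall.Plane d, 4 * a ^ 2 * nhsNormSq (ζ z) :=
          Finset.sum_le_sum fun π _ => nhsNormSq_curlAt_gaugeDir_le hW hWa ζ z (ne_of_lt π.2)
      _ = (Fintype.card (T4AveragingDeficitWall.Plane d) : ℝ) * (4 * a ^ 2 * nhsNormSq (ζ z)) := by
          rw [Finset.sum_const, nsmul_eq_mul, Finset.card_univ]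
      _ ≤ (d : ℝ) ^ 2 * (4 * a ^ 2 * nhsNormSq (ζ z)) :=
          mul_le_mul_of_nonneg_right (card_plane_le d) (by have := nhsNormSq_nonneg (ζ z); positivity)
  calc ∑ z ∈ F, ∑ π : T4AveragingDeficitWall.Plane d, nhsNormSq (curl W (gaugeDir W ζ) (z, π))
      ≤ ∑ z ∈ F, (d : ℝ) ^ 2 * (4 * a ^ 2 * nhsNormSq (ζ z)) := Finset.sum_le_sum hpt
    _ = 4 * (d : ℝ) ^ 2 * a ^ 2 * ∑ z ∈ F, nhsNormSq (ζ z) := by rw [Finset.mul_sum]; exact Finset.sum_congr rfl fun z _ => by ring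

/-- **THE CURL OF `Y − gaugeDir W ζ`** (unitary `W`, `SmallField W a`):
`Σ_{z∈F} Σ_π nhsNormSq (curl W (Y − gaugeDir W ζ) (z,π)) ≤ 2·Σ_{z∈F} Σ_π nhsNormSq (curl W Y (z,π)) + 8·d²·a²·Σ_{z∈F} nhsNormSq (ζ z)`. [folklore] -/
theorem sum_nhsNormSq_curl_sub_gaugeDir_le [Nonempty n] {W : Site d → Fin d → (Matrix n n ℂ)ˣ} (hW : IsUnitaryCfg W) {a : ℝ}
    (hWa : SmallField W a) (Y : Site d → Fin d → Matrix n n ℂ) (ζ : Site d → Matrix n n ℂ) (F : Finset (Site d)) :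
    ∑ z ∈ F, ∑ π : T4AveragingDeficitWall.Plane d, nhsNormSq (curl W (fun x κ => Y x κ - gaugeDir W ζ x κ) (z, π))
      ≤ 2 * ∑ z ∈ F, ∑ π : T4AveragingDeficitWall.Plane d, nhsNormSq (curl W Y (z, π))
        + 8 * (d : ℝ) ^ 2 * a ^ 2 * ∑ z ∈ F, nhsNormSq (ζ z) := by
  have hpt : ∀ (z : Site d) (π : T4AveragingDeficitWall.Plane d),
      nhsNormSq (curl W (fun x κ => Y x κ - gaugeDir W ζ x κ) (z, π))
        ≤ 2 * (nhsNormSq (curl W Y (z, π)) + nhsNormSq (curl W (gaugeDir W ζ) (z, π))) := by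
    intro z π
    show nhsNormSq (curlAt W (fun x κ => Y x κ - gaugeDir W ζ x κ) z π.1.1 π.1.2)
      ≤ 2 * (nhsNormSq (curlAt W Y z π.1.1 π.1.2) + nhsNormSq (curlAt W (gaugeDir W ζ) z π.1.1 π.1.2))
    rw [curlAt_sub]
    exact nhsNormSq_sub_le _ _
  have h1 := sum_nhsNormSq_curl_gaugeDir_le hW hWa ζ F
  calc ∑ z ∈ F, ∑ π : T4AveragingDeficitWall.Plane d, nhsNormSq (curl W (fun x κ => Y x κ - gaugeDir W ζ x κ) (z, π))
      ≤ ∑ z ∈ F, ∑ π : T4AveragingDeficitWall.Plane d,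
          2 * (nhsNormSq (curl W Y (z, π)) + nhsNormSq (curl W (gaugeDir W ζ) (z, π))) :=
        Finset.sum_le_sum fun z _ => Finset.sum_le_sum fun π _ => hpt z π
    _ = 2 * ∑ z ∈ F, ∑ π : T4AveragingDeficitWall.Plane d, nhsNormSq (curl W Y (z, π))
        + 2 * ∑ z ∈ F, ∑ π : T4AveragingDeficitWall.Plane d, nhsNormSq (curl W (gaugeDir W ζ) (z, π)) := by
        simp only [mul_add, Finset.sum_add_distrib, Finset.mul_sum]
    _ ≤ _ := by nlinarith [h1]

/-! ## §2 The (S5) budget line -/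

/-- **(S5) — THE COVARIANT-GRADIENT ENERGY OF `η′ = Y − gaugeDir W ζ′`** (`P ≥ 1`, unitary `P`-periodic `W` with `SmallField W a`, `0 ≤ a`,
`P`-periodic `Y` and `ζ`; `η′ := Y − gaugeDir W ζ` pointwise):
`Σ_xΣ_μΣ_ν nhsNormSq (covFd W η′ x μ ν) ≤ 4·Σ_zΣ_π nhsNormSq (curl W Y (z,π)) + 16d²a²·Σ nhsNormSq ζ + Σ nhsNormSq (covDiv W η′) + (2da + 32da²)·card n·Σ_xΣ_κ nhsNormSq (η′ x κ)`
over `periodBox P` (w4-W's covariant Weitzenböck + the owner's plaquette commutator + `‖X‖² ≤ card n·nhsNormSq X`). [folklore] -/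
theorem covFd_energy_le [Nonempty n] {P : ℕ} (hP : 1 ≤ P) {W : Site d → Fin d → (Matrix n n ℂ)ˣ} (hW : IsUnitaryCfg W)
    (hWP : IsPeriodicCfg W (P : ℤ)) {a : ℝ} (ha : 0 ≤ a) (hWa : SmallField W a)
    {Y : Site d → Fin d → Matrix n n ℂ} (hY : IsPeriodicDir Y (P : ℤ)) {ζ : Site d → Matrix n n ℂ}
    (hζ : ∀ (x : Site d) (τ : Fin d), ζ (x + (P : ℤ) • e τ) = ζ x) {η' : Site d → Fin d → Matrix n n ℂ}
    (hη' : ∀ (x : Site d) (κ : Fin d), η' x κ = Y x κ - gaugeDir W ζ x κ) :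
    ∑ x ∈ periodBox (d := d) P, ∑ μ : Fin d, ∑ ν : Fin d, nhsNormSq (covFd W η' x μ ν)
      ≤ 4 * ∑ z ∈ periodBox (d := d) P, ∑ π : T4AveragingDeficitWall.Plane d, nhsNormSq (curl W Y (z, π))
        + 16 * (d : ℝ) ^ 2 * a ^ 2 * ∑ z ∈ periodBox (d := d) P, nhsNormSq (ζ z)
        + ∑ x ∈ periodBox (d := d) P, nhsNormSq (covDiv W η' x)
        + (2 * d * a + 32 * d * a ^ 2) * ((Fintype.card n : ℝ) * ∑ x ∈ periodBox (d := d) P, ∑ κ : Fin d, nhsNormSq (η' x κ)) := by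
  have hfun : η' = fun x κ => Y x κ - gaugeDir W ζ x κ := funext fun x => funext fun κ => hη' x κ
  have hη'P : IsPeriodicDir η' (P : ℤ) := by
    intro x τ κ
    rw [hη', hη', hY x τ κ, isPeriodicDir_gaugeDir hWP hζ x τ κ]
  have hw4 := sum_nhsNormSq_covFd_le hP hW hWP ha hWa hη'P
  -- the curl term in nhs currency over sites and planes
  have hcurl : ∑ p ∈ plaqsOf (periodBox (d := d) P), nhsNormSq (curl W η' p)
      ≤ 2 * ∑ z ∈ periodBox (d := d) P, ∑ π : T4AveragingDeficitWall.Plane d, nhsNormSq (curl W Y (z, π))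
        + 8 * (d : ℝ) ^ 2 * a ^ 2 * ∑ z ∈ periodBox (d := d) P, nhsNormSq (ζ z) := by
    rw [sum_plaqsOf, hfun]
    exact sum_nhsNormSq_curl_sub_gaugeDir_le hW hWa Y ζ _
  -- the operator-norm `dirSq` against `card n · Σ nhsNormSq`
  have hdir := dirSq_le_card_mul (n := n) η' (periodBox (d := d) P)
  have hc : 0 ≤ 2 * (d : ℝ) * a + 32 * d * a ^ 2 := by positivity
  have hdir' := mul_le_mul_of_nonneg_left hdir hc
  linarith

end

end Summit.QuantumFields.BalabanUV.T4Continuum.NE3SlicePoincareGradientBudget
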